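import Summits.BirchSwinnertonDyer.BirchSwinnertonDyer.Theorems.SignedLowerHalvesSmallImageLowerHalfBothSignsRttCharRoadE2DepletedOfTwist
import Summits.BirchSwinnertonDyer.BirchSwinnertonDyer.Theorems.SignedLowerHalvesSmallImageLowerHalfBothSignsRttD2SeqGlueSocket
import HarnessLib

/-!
# Route `SignedLowerHalves`, crux L `SmallImageLowerHalfBothSigns` (stmt-BirchSwinnertonDyer-23599), line `rtt_w3` v14 → v15 — E2 (RULING «U»): THE v15 CONSUMER (DEPLETED FORM, RULING (F1)) ON THE
# STUB'S CARRIERS — `charRoad_E2_of_roadD_junction_depleted_of_twist` (LEAD) at `Q := DQ.X`, `X' := Dψ.X`, `gX := gXLinearMapO …`, `M := Cofree θ F` (the plumbing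
# of -w3 g20's `charRoad_E2_of_locSat_cofree`, p779479), so the v15 glue `charRoad_E2_of_junction_tails` can be the shape of p780953

WHY (HELPER-TABLE addendum 10 «v15 PLAN»; LEAD `cruxlead-stmt-BirchSwinnertonDyer-23599` g11). -w3 g20's `charRoad_E2_of_locSat_cofree` is `charRoad_E2_of_localisation` with
`Q`, `X'`, `gX` PINNED to the stub's carriers (`DQ.X`, `Dψ.X`, `gXLinearMapO`, pinned `Λ_𝒪`-structures `instX instQ hιX hιQ hCX hCQ`, torsion/stabiliser binders discharged
for `M = Cofree θ F`). THIS FILE does the same for the twisted-skeleton consumer: ★★★★★★ `charRoad_E2_of_roadD_junction_depleted_of_twist_cofree` — binders = those of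
`charRoad_E2_of_locSat_cofree` up to `hCQ`, then the road-D frame of RULING «U» (`b ∈ 𝔪`, φ-clauses, source skeleton `Dχ` with `Thm52Shape` + finiteness (FACT),
`σ`, target skeleton `Dθ`, semilinear `e₀ e₁ e₂` with `haZ` (row D-tw-coh), `hH1 : H1[f] = 0` (⟸ hTF), `a`/`ha` (rows 𝔞), pinned structures), then the DEPLETED junction
(`B s htB hcoker`, strict sub-carrier `ιB : B' ↪ B`, depletion `E`, `s'` with `ιB ∘ s' = E • s`, `j₀ : B' →ₗ[Λ_𝒪] DQ.X`, `hexact : Function.Exact j₀ gX`,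
`hY : λ(H2/f) + λ(Λ_𝒪⧸(E)) ≤ λ(coker gX) + λ(B⧸range ιB)`), then `Col`, (an), `hCol` for `z := j₀ (s' (zetaSp f Dθ a))`; conclusion = the
E2-tail of `stub_charRoad_ns` for `Dψ.X` VERBATIM.

THEOREMS ONLY (`--supports stmt-BirchSwinnertonDyer-23599` helper); closes nothing; crux L, crux M, E2 and BSD remain OPEN and are proved for NO curve by any of this.
[cite: Kobayashi2003, Thm. 7.3 i), Thm. 1.3] [cite: JohnsonLeungKings2011, Thm. 5.2, Cor. 5.3] [cite: PollackRubin2004, §6–§7] [cite: Rubin2000, Ch. VI §1–§2]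
-/

set_option autoImplicit false
-- the Theorems namespace of this sub repeats the summit name by design (D-0017 nested layout)
set_option linter.dupNamespace false

noncomputable section

open scoped MatrixGroups ModularForm
open PowerSeries Literature.NumberTheory.IwasawaTheory CongruenceSubgroup Rat.HeightOneSpectrum Literature.NumberTheory.EllipticCurves.ModularForms
  Summit.BirchSwinnertonDyer.BirchSwinnertonDyer.Theorems.SmallImageRttCharRoad
open Literature.NumberTheory.EllipticCurves Literature.NumberTheory.EllipticCurves.GreenbergVatsal2000 NumberField IsDedekindDomain Field
open Literature.NumberTheory.GaloisRepresentations
open Literature.NumberTheory.ComplexMultiplication.EllipticUnits.JohnsonLeungKings2011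
open Summit.BirchSwinnertonDyer.BirchSwinnertonDyer.Theorems.SmallImageRttD2Spec
open Summit.BirchSwinnertonDyer.BirchSwinnertonDyer.Theorems.SmallImageCharSignedSelmer

namespace Summit.BirchSwinnertonDyer.BirchSwinnertonDyer.Theorems.SmallImageRttD2Seq

section CofreeTwistDepleted

variable {K : Type} [Field K] [NumberField K] {p : ℕ} [Fact p.Prime] {κ : ZpExtension K p} {S : Set (PadicAlgCl p)}
  {θ : FramedGaloisRep K (padicCoeffIntegers S) 1} {V : WeierstrassCurve K}
  {j : V.geomPrimaryTorsion p →+ GreenbergSelmer.Cofree θ (padicCoeffField S)} {ε : ℤˣ} {v : HeightOneSpectrum (𝓞 K)}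

set_option maxHeartbeats 400000 in -- same budget line as p780454/p782277/p782680
/-- ★★★★★★ **The v15 consumer (depleted form) on the stub's carriers.** `charRoad_E2_of_roadD_junction_depleted_of_twist` with `Q := DQ.X`, `X' := Dψ.X`, `gX := gXLinearMapO …`
for the stub's coefficients `M = Cofree θ F`, the local binders discharged as in `charRoad_E2_of_locSat_cofree`. See the module docstring for the binder groups.
[cite: Kobayashi2003, Thm. 7.3 i)] [cite: JohnsonLeungKings2011, Thm. 5.2, Cor. 5.3] [cite: Rubin2000, Ch. VI §1–§2] -/
theorem charRoad_E2_of_roadD_junction_depleted_of_twist_cofree [FiniteDimensional ℚ_[p] (padicCoeffField S)] [Algebra (IwasawaAlgebra p) (IwasawaAlgebraO S)]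
    [IsLocalRing (padicCoeffIntegers S)]
    [DistribMulAction (absoluteGaloisGroup (v.adicCompletion K)) (GreenbergSelmer.Cofree θ (padicCoeffField S))]
    [SMulCommClass (absoluteGaloisGroup (v.adicCompletion K)) (padicCoeffIntegers S) (GreenbergSelmer.Cofree θ (padicCoeffField S))]
    (hres : ∀ (σ : absoluteGaloisGroup (v.adicCompletion K)) (m : GreenbergSelmer.Cofree θ (padicCoeffField S)),
      σ • m = resGalOfEmb (closureEmb (K := K) (v.adicCompletion K)) σ • m)
    (hS : 0 < Module.finrank ℚ_[p] (padicCoeffField S))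
    (halg : ∀ r : IwasawaAlgebra p, algebraMap (IwasawaAlgebra p) (IwasawaAlgebraO S) r = iwasawaToIwasawaO S r)
    {N : ℕ} [NeZero N] (g : CuspForm (Gamma0 N) 2) (ι : coeffField g →+* PadicAlgCl p) (hng : IsNewform0 g)
    (S₀ : Finset (HeightOneSpectrum (𝓞 ℚ))) {S₀K : Set (HeightOneSpectrum (𝓞 K))} {γ : absoluteGaloisGroup K}
    (D : SignedTransportDualDataSat κ γ (GreenbergSelmer.Cofree θ (padicCoeffField S)) (padicCoeffIntegers S) V j S₀K ε)
    [Module.Finite (IwasawaAlgebra p) D.X] (hX : Module.IsTorsion (IwasawaAlgebra p) D.X) (hγ : κ.IsTopGenerator γ)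
    (hvp : (p : 𝓞 K) ∈ v.asIdeal) (hv : AcSigned.IsNonsplitIn κ v) {γv : absoluteGaloisGroup (v.adicCompletion K)}
    (hγv : κ.IsTopGenerator (resGalOfEmb (closureEmb (K := K) (v.adicCompletion K)) γv))
    (DQ : LocalCondDualData κ (GreenbergSelmer.Cofree θ (padicCoeffField S)) (padicCoeffIntegers S) V j ε v γv)
    (instX : Module (IwasawaAlgebraO S) D.X) (instQ : Module (IwasawaAlgebraO S) DQ.X)
    (hιX : ∀ (f : IwasawaAlgebra p) (x : D.X), (letI := instX; iwasawaToIwasawaO S f • x) = f • x)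
    (hιQ : ∀ (f : IwasawaAlgebra p) (x : DQ.X), (letI := instQ; iwasawaToIwasawaO S f • x) = f • x)
    (hCX : ∀ (a : padicCoeffIntegers S) (x : D.X)
        (s : signedTransportSelmerInftySat κ (GreenbergSelmer.Cofree θ (padicCoeffField S)) (padicCoeffIntegers S) V j S₀K ε),
      D.toDual (letI := instX; (PowerSeries.C a : IwasawaAlgebraO S) • x) s =
        D.toDual x ⟨GreenbergSelmer.scalarH1 κ.kerSubgroup _ a s, scalarH1_mem_signedTransportSelmerInftySat κ _ (padicCoeffIntegers S) V j S₀K ε a s.2⟩)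
    (hCQ : ∀ (a : padicCoeffIntegers S) (x : DQ.X) (c : localCondInftySat κ (GreenbergSelmer.Cofree θ (padicCoeffField S)) (padicCoeffIntegers S) V j ε v),
        DQ.toDual (letI := instQ; (PowerSeries.C a : IwasawaAlgebraO S) • x) c =
          DQ.toDual x (scalarLocalSat κ (GreenbergSelmer.Cofree θ (padicCoeffField S)) (padicCoeffIntegers S) V j ε v a c))
    -- ROAD D (RULING «U»): the source skeleton `Dχ` (honda's datum for `χ₀`, FACT) and its transport `Dθ` (skeleton for `θ*`) along `σ = Tw_η`
    (b : padicCoeffIntegers S) (hb : b ∈ IsLocalRing.maximalIdeal (padicCoeffIntegers S)) (φ : PowerSeries (IwasawaAlgebraO S) →+* IwasawaAlgebraO S)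
    (hφf : φ (C (X - C b)) = 0) (hC : ∀ a : padicCoeffIntegers S, φ (C (C a)) = C a) (hφX : φ X = X)
    (hker : RingHom.ker φ = Ideal.span {C (X - C b)})
    {Aidx H0 H1 H2 : Type} [AddCommGroup H0] [Module (PowerSeries (IwasawaAlgebraO S)) H0] [AddCommGroup H1] [Module (PowerSeries (IwasawaAlgebraO S)) H1] [AddCommGroup H2] [Module (PowerSeries (IwasawaAlgebraO S)) H2]
    {H0₀ H1₀ H2₀ : Type} [AddCommGroup H0₀] [Module (PowerSeries (IwasawaAlgebraO S)) H0₀] [AddCommGroup H1₀] [Module (PowerSeries (IwasawaAlgebraO S)) H1₀] [AddCommGroup H2₀] [Module (PowerSeries (IwasawaAlgebraO S)) H2₀]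
    [Module.Finite (PowerSeries (IwasawaAlgebraO S)) H1₀] [Module.Finite (PowerSeries (IwasawaAlgebraO S)) H2₀]
    (Dχ : ZetaSkeleton (PowerSeries (IwasawaAlgebraO S)) Aidx H0₀ H1₀ H2₀) (h52χ : Dχ.Thm52Shape)
    (σ : PowerSeries (IwasawaAlgebraO S) ≃+* PowerSeries (IwasawaAlgebraO S))
    (Dθ : ZetaSkeleton (PowerSeries (IwasawaAlgebraO S)) Aidx H0 H1 H2)
    (e₀ : H0₀ ≃+ H0) (e₁ : H1₀ ≃+ H1) (he₁ : ∀ (r : PowerSeries (IwasawaAlgebraO S)) (m : H1₀), e₁ (r • m) = σ r • e₁ m)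
    (haZ : ∀ a : Aidx, e₁ (Dχ.aZeta a) = Dθ.aZeta a)
    (e₂ : H2₀ ≃+ H2) (he₂ : ∀ (r : PowerSeries (IwasawaAlgebraO S)) (m : H2₀), e₂ (r • m) = σ r • e₂ m)
    (hH1 : Submodule.torsionBy (PowerSeries (IwasawaAlgebraO S)) H1 (C (X - C b)) = ⊥) (a : Aidx) (ha : IsUnit (φ (Dθ.nsub a)))
    [Module (IwasawaAlgebraO S) (QuotSMulTop (C (X - C b) : PowerSeries (IwasawaAlgebraO S)) H1)]
    (hιH : ∀ (l : IwasawaAlgebraO S) (x : QuotSMulTop (C (X - C b) : PowerSeries (IwasawaAlgebraO S)) H1),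
      l • x = (PowerSeries.map (PowerSeries.C : padicCoeffIntegers S →+* IwasawaAlgebraO S) l) • x)
    [Module (IwasawaAlgebra p) (QuotSMulTop (C (X - C b) : PowerSeries (IwasawaAlgebraO S)) H1)]
    [IsScalarTower (IwasawaAlgebra p) (IwasawaAlgebraO S) (QuotSMulTop (C (X - C b) : PowerSeries (IwasawaAlgebraO S)) H1)]
    [Module (IwasawaAlgebra p) (Submodule.torsionBy (PowerSeries (IwasawaAlgebraO S)) H2 (C (X - C b)))]
    (hΛT : ∀ (r : IwasawaAlgebra p) (x : Submodule.torsionBy (PowerSeries (IwasawaAlgebraO S)) H2 (C (X - C b))),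
      r • x = (PowerSeries.map (PowerSeries.C : padicCoeffIntegers S →+* IwasawaAlgebraO S) (iwasawaToIwasawaO S r)) • x)
    [Module (IwasawaAlgebra p) (QuotSMulTop (C (X - C b) : PowerSeries (IwasawaAlgebraO S)) H2)]
    (hΛ2 : ∀ (r : IwasawaAlgebra p) (x : QuotSMulTop (C (X - C b) : PowerSeries (IwasawaAlgebraO S)) H2),
      r • x = (PowerSeries.map (PowerSeries.C : padicCoeffIntegers S →+* IwasawaAlgebraO S) (iwasawaToIwasawaO S r)) • x)
    -- THE DEPLETED JUNCTION (RULING (F1)) against `Q := DQ.X`, `gX := gXLinearMapO …`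
    {B : Type} [AddCommGroup B] [Module (IwasawaAlgebraO S) B] [Module (IwasawaAlgebra p) B]
    [IsScalarTower (IwasawaAlgebra p) (IwasawaAlgebraO S) B] [Module.Finite (IwasawaAlgebra p) B]
    {B' : Type} [AddCommGroup B'] [Module (IwasawaAlgebraO S) B'] [Module (IwasawaAlgebra p) B'] [IsScalarTower (IwasawaAlgebra p) (IwasawaAlgebraO S) B']
    (s : QuotSMulTop (C (X - C b) : PowerSeries (IwasawaAlgebraO S)) H1 →ₗ[IwasawaAlgebraO S] B)
    (htB : Module.IsTorsion (IwasawaAlgebra p) (B ⧸ LinearMap.range s))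
    (hcoker : lambdaInvariant p (B ⧸ LinearMap.range s) ≤ lambdaInvariant p (Submodule.torsionBy (PowerSeries (IwasawaAlgebraO S)) H2 (C (X - C b))))
    (ιB : B' →ₗ[IwasawaAlgebraO S] B) (hιB : Function.Injective ιB) (E : IwasawaAlgebraO S) (hE : E ≠ 0)
    (s' : QuotSMulTop (C (X - C b) : PowerSeries (IwasawaAlgebraO S)) H1 →ₗ[IwasawaAlgebraO S] B') (hs' : ∀ x, ιB (s' x) = E • s x)
    (j₀ : letI := instQ; B' →ₗ[IwasawaAlgebraO S] DQ.X)
    (hexact : letI := instX; letI := instQ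
      haveI : IsScalarTower (IwasawaAlgebra p) (IwasawaAlgebraO S) D.X := isScalarTower_iwasawaAlgebraO_of_smul_eq S halg hιX
      haveI : IsScalarTower (IwasawaAlgebra p) (IwasawaAlgebraO S) DQ.X := isScalarTower_iwasawaAlgebraO_of_smul_eq S halg hιQ
      let gX := gXLinearMapO S D DQ hres hvp instX instQ hιX hιQ hCX hCQ (GreenbergSelmer.exists_pow_smul_cofree_eq_zero S θ)
        (GreenbergSelmer.isOpen_stabilizer_cofree S θ)
        (isOpen_stabilizer_of_hres (GreenbergSelmer.Cofree θ (padicCoeffField S)) v hres (GreenbergSelmer.isOpen_stabilizer_cofree S θ)) hγ hv hγv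
      Function.Exact j₀ gX)
    (hY : letI := instX; letI := instQ
      haveI : IsScalarTower (IwasawaAlgebra p) (IwasawaAlgebraO S) D.X := isScalarTower_iwasawaAlgebraO_of_smul_eq S halg hιX
      haveI : IsScalarTower (IwasawaAlgebra p) (IwasawaAlgebraO S) DQ.X := isScalarTower_iwasawaAlgebraO_of_smul_eq S halg hιQ
      let gX := gXLinearMapO S D DQ hres hvp instX instQ hιX hιQ hCX hCQ (GreenbergSelmer.exists_pow_smul_cofree_eq_zero S θ)
        (GreenbergSelmer.isOpen_stabilizer_cofree S θ)
        (isOpen_stabilizer_of_hres (GreenbergSelmer.Cofree θ (padicCoeffField S)) v hres (GreenbergSelmer.isOpen_stabilizer_cofree S θ)) hγ hv hγv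
      lambdaInvariant p (QuotSMulTop (C (X - C b) : PowerSeries (IwasawaAlgebraO S)) H2) + lambdaInvariant p (IwasawaAlgebraO S ⧸ Ideal.span {E}) ≤
        lambdaInvariant p (D.X ⧸ LinearMap.range gX) + lambdaInvariant p (B ⧸ LinearMap.range ιB))
    -- (Col), (an), (7′) for `z := j₀ (s' ζ̄_a)`
    (Col : letI := instQ; DQ.X ≃ₗ[IwasawaAlgebraO S] IwasawaAlgebraO S)
    (L : IwasawaAlgebraO (Set.range ι)) (hL : L ≠ 0) {c : PadicAlgCl p} (hc : c ≠ 0)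
    (fv : HeightOneSpectrum (𝓞 ℚ) → ℤ_[p])
    (hfv : ∀ w ∈ S₀, fv w ≠ 0 ∧ (fv w).valuation = (frobeniusExponent p (natGenerator w : ℤ_[p])).valuation)
    (hCol : iwasawaOToPowerSeries S ((letI := instQ; Col (j₀ (s' (zetaSp (C (X - C b) : PowerSeries (IwasawaAlgebraO S)) Dθ a))))) =
      PowerSeries.C c * iwasawaOToPowerSeries (Set.range ι) L *
        ∏ w ∈ S₀, Polynomial.aeval (PowerSeries.C ((natGenerator w : PadicAlgCl p)⁻¹) *
            (PowerSeries.binomialSeries ℤ_[p] (fv w)).map (algebraMap ℤ_[p] (PadicAlgCl p)))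
          (1 - Polynomial.C (embCoeff g ι (natGenerator w)) * Polynomial.X +
            (if natGenerator w ∣ N then 0 else Polynomial.C (natGenerator w : PadicAlgCl p)) * Polynomial.X ^ 2)) :
    ∃ d : ℕ, (∀ k : ℕ, ‖PowerSeries.coeff k (iwasawaOToPowerSeries (Set.range ι) L)‖ ≤
        ‖PowerSeries.coeff d (iwasawaOToPowerSeries (Set.range ι) L)‖) ∧
      (∀ k : ℕ, k < d → ‖PowerSeries.coeff k (iwasawaOToPowerSeries (Set.range ι) L)‖ <
        ‖PowerSeries.coeff d (iwasawaOToPowerSeries (Set.range ι) L)‖) ∧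
      Module.finrank ℚ_[p] (padicCoeffField S) * (d + ∑ w ∈ S₀, p ^ (frobeniusExponent p (natGenerator w : ℤ_[p])).valuation *
        layerLambda ((1 - Polynomial.C (embCoeff g ι (natGenerator w)) * Polynomial.X +
          (if natGenerator w ∣ N then 0 else Polynomial.C (natGenerator w : PadicAlgCl p)) * Polynomial.X ^ 2).comp
            (Polynomial.C ((natGenerator w : PadicAlgCl p)⁻¹) * (Polynomial.X + 1)))) ≤ lambdaInvariant p D.X := by
  letI := instX; letI := instQ
  haveI : IsScalarTower (IwasawaAlgebra p) (IwasawaAlgebraO S) D.X := isScalarTower_iwasawaAlgebraO_of_smul_eq S halg hιX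
  haveI : IsScalarTower (IwasawaAlgebra p) (IwasawaAlgebraO S) DQ.X := isScalarTower_iwasawaAlgebraO_of_smul_eq S halg hιQ
  exact charRoad_E2_of_roadD_junction_depleted_of_twist hS halg g ι hng S₀ hX
    (gXLinearMapO S D DQ hres hvp instX instQ hιX hιQ hCX hCQ (GreenbergSelmer.exists_pow_smul_cofree_eq_zero S θ)
        (GreenbergSelmer.isOpen_stabilizer_cofree S θ)
        (isOpen_stabilizer_of_hres (GreenbergSelmer.Cofree θ (padicCoeffField S)) v hres (GreenbergSelmer.isOpen_stabilizer_cofree S θ)) hγ hv hγv)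
    b hb φ hφf hC hφX hker Dχ h52χ σ Dθ e₀ e₁ he₁ haZ e₂ he₂ hH1 a ha hιH hΛT hΛ2 s htB hcoker ιB hιB E hE s' hs' j₀ hexact hY Col L hL hc fv hfv hCol

end CofreeTwistDepleted

end Summit.BirchSwinnertonDyer.BirchSwinnertonDyer.Theorems.SmallImageRttD2Seq

end
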